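import Literature.Analysis.Complex.PositiveKernelPolydisc
import Literature.Analysis.Complex.WeakHolomorphy
import Literature.Analysis.Complex.RealEnvironment
import Literature.Analysis.Complex.OsgoodProofs
import Literature.MathematicalPhysics.QuantumFieldTheory.OSGlaserVectors
import Mathlib.Analysis.Normed.Module.HahnBanach
import Mathlib.Analysis.InnerProductSpace.Projection.Submodule
import Mathlib.LinearAlgebra.Isomorphisms
import HarnessLib

/-!
# Holomorphic vectors from a sesqui-holomorphic Gram kernel (OS II, Ch. V.2, the step (P_N))

Topic `Literature/MathematicalPhysics/QuantumFieldTheory`; support file (everything proved, no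
definitions, no named facts) for the discharge of (A1) `OS1975_exists_timeContinuation`
(Osterwalder–Schrader II, Thm. 4.3). It isolates, in abstract Hilbert-space form, the step
**(A_N) ⇒ (P_N)** of Osterwalder–Schrader, *Axioms for Euclidean Green's functions II*, Comm. Math.
Phys. 42 (1975), Ch. V.2, pp. 294–295, eqs. (5.16)–(5.21): *"Now we define the vector `Ψₙ(x, ζ)`
by `Ψₙ(x, ζ) = ∑ (ζ - ξ)^α/α! ∂^α Ψₙ(x, ξ)` … The right hand side of (5.20) converges in norm, for
`‖∑ …‖²` is just the remainder term of the Taylor expansion of `S_{2n-1}(ζ̄, 2x, ζ)` about the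
point `(ξ, 2x, ξ)` … Relation (5.17) follows easily from (5.20)."* — i.e. vectors attached to the
*real* points, whose Gram kernel is the restriction of a function holomorphic (in `ζ`) and
antiholomorphic (in `ζ'`) on polydiscs about the real points, extend to a holomorphic
vector-valued map with the continued Gram kernel.

**Theorem** (`exists_holomorphic_gramVec`). Let `H` be a complex Hilbert space,
`Φ : ℝᵐ → H` (only its values at the real points of `Ω` matter), `Ω ⊆ ℂᵐ`, and
`k : ℂᵐ → ℂᵐ → ℂ`. Assume that every `z ∈ Ω` lies in an open polydisc `P = D(ξ, r) ⊆ Ω` with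
*real* centre such that `k` is jointly holomorphic on `P × P`, and that on real points
`⟪Φ η', Φ η⟫ = k(η', η)` (`η, η' ∈ Ω ∩ ℝᵐ`). Then there is `Ψ : ℂᵐ → H`, holomorphic on `Ω`, with
`Ψ = Φ` at the real points of `Ω`, `Ψ z` in the closed span of `Φ(Ω ∩ ℝᵐ)`, and
`⟪Ψ w, Ψ z⟫ = k(w̄, z)` for `w, z` in any such polydisc (in particular `‖Ψ z‖² = Re k(z̄, z)`).
Holomorphic `H`-valued maps are determined by their real-point values
(`eqOn_of_eqOn_reals_hilbert`), so `Ψ` is unique.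

In OS II: `m = n - 1`, `Φ(ξ) = Ψₙ(x, ξ)` (`x > 0` fixed), `k(w, z) = S_{2n-1}(rev w, 2x, z)` with
the level-`N` continuation `S_{2n-1}` (so that `k(w̄, z) = S_{2n-1}(θw, 2x, z)`, `θ` = reversed
complex conjugate), `Ω` = the `ζ`-section of `D_n^{(N)}`; the polydisc hypothesis is OS's remark
before (5.19) ("with `(x, ζ)` the whole cone of points … is contained in `D_n^{(N)}`. We therefore
can find points `ξᵢ ∈ (0, ∞)` and numbers `rᵢ > 0`, such that the whole polydisc … is contained in
`D_n^{(N)}`", by the solidity of the bases, `OSEnvelopeBases`).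

## Proof (reproducing-kernel route instead of OS's vector-valued Taylor series)

On one polydisc `P` (`exists_holomorphic_gramVec_polydisc`): the kernel `K(w, z) = k(w̄, z)` is
positive-semidefinite on the real points of `P` (it is a Gram kernel there), hence on `P` by
Glaser's lemma on polydiscs (`isPosSemidefKernelOn_polydisc_of_real`, `PositiveKernelPolydisc`);
the Cauchy–Schwarz inequality for `K` (`IsPosSemidefKernelOn.norm_sum_mul_sq_le`) bounds the
functional `∑ cᵢ Φ(ηᵢ) ↦ ∑ cᵢ K(z, ηᵢ)` by `√K(z,z) ‖∑ cᵢ Φ(ηᵢ)‖`, so (first isomorphism theorem,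
Hahn–Banach, Riesz, orthogonal projection) there is `Ψ z` in the closed span `V` of the `Φ(η)` with
`⟪Ψ z, Φ η⟫ = K(z, η)` and `‖Ψ z‖ ≤ √K(z,z)`; `z ↦ ⟪v, Ψ z⟫` is holomorphic for `v` in a set with
dense span in `V` and vanishes for `v ⊥ V`, and `Ψ` is locally bounded, so `Ψ` is holomorphic
(`differentiableOn_of_weakly_holomorphic_pi`, `WeakHolomorphy`); `Ψ = Φ` at real points
(`V ∩ V^⊥ = 0`) and the Gram identity follows from its real-point case by the identity theorem
for real environments (`RealEnvironment`). Local pieces on overlapping polydiscs agree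
(`eqOn_of_eqOn_reals_hilbert`: the intersection is convex and contains real points), which glues
`Ψ` on `Ω`.

## References

* K. Osterwalder, R. Schrader, *Axioms for Euclidean Green's functions II*, Comm. Math. Phys. 42
  (1975) 281–305, Ch. V.2, (5.16)–(5.21). [OsterwalderSchraderCMP1975]
* V. Glaser, *On the equivalence of the Euclidean and Wightman formulation of field theory*,
  Comm. Math. Phys. 37 (1974) 257–272, §2. [GlaserCMP1974]
-/

noncomputable section

open Metric Set Filter Complex
open scoped Topology ComplexOrder ComplexConjugate BigOperators InnerProductSpace

namespace Literature.MathematicalPhysics.QuantumFieldTheory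

open Literature.Analysis.Complex

variable {m : ℕ} {H : Type*} [NormedAddCommGroup H] [InnerProductSpace ℂ H]

/-! ### Real environments: scalar- and Hilbert-space-valued uniqueness -/

/-- Real points of a real-centred polydisc are fixed by coordinatewise conjugation. [folklore] -/
theorem star_ofReal_pt (η : Fin m → ℝ) : star (fun i => (η i : ℂ)) = fun i => (η i : ℂ) := by
  funext i; simp only [Pi.star_apply, Complex.star_def, Complex.conj_ofReal]

/-- The coordinatewise real part of a point of a real-centred polydisc is a real point of it. [folklore] -/
theorem re_mem_polydisc_ofReal {ξ r : Fin m → ℝ} {z : Fin m → ℂ}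
    (hz : z ∈ polydisc (fun i => (ξ i : ℂ)) r) :
    (fun i => ((z i).re : ℂ)) ∈ polydisc (fun i => (ξ i : ℂ)) r := by
  rw [mem_polydisc] at hz ⊢
  intro i
  have h := hz i
  rw [mem_ball, dist_eq_norm] at h ⊢
  refine lt_of_le_of_lt ?_ h
  rw [← Complex.ofReal_sub, Complex.norm_real, Real.norm_eq_abs]
  simpa using Complex.abs_re_le_norm (z i - ξ i)

/-- A real-centred polydisc is convex. [folklore] -/
theorem convex_polydisc (c : Fin m → ℂ) (r : Fin m → ℝ) : Convex ℝ (polydisc c r) :=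
  convex_pi fun i _ => convex_ball (c i) (r i)

/-- **Real environments, scalar form**: a function holomorphic on an open preconnected
`U ⊆ ℂᵐ` containing a real point, and vanishing at all real points of `U`, vanishes on `U`
(Streater–Wightman §2-3; from `SCV.eventually_eq_zero_of_eq_zero_on_reals_pi` and the identity
theorem, analyticity by Osgood's lemma). [cite: StreaterWightman1964, §2-3 (pdf p. 46)] -/
theorem eqOn_zero_of_eq_zero_on_reals {f : (Fin m → ℂ) → ℂ} {U : Set (Fin m → ℂ)}
    (hU : IsOpen U) (hUc : IsPreconnected U) (hf : DifferentiableOn ℂ f U) {x₀ : Fin m → ℝ}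
    (hx₀ : (fun i => (x₀ i : ℂ)) ∈ U)
    (h0 : ∀ w : Fin m → ℝ, (fun i => (w i : ℂ)) ∈ U → f (fun i => (w i : ℂ)) = 0) :
    EqOn f 0 U := by
  obtain ⟨ρ, hρ, hball⟩ := Metric.isOpen_iff.1 hU _ hx₀
  have han : AnalyticOnNhd ℂ f U := SCV.analyticOnNhd_of_differentiableOn hf hU
  refine han.eqOn_zero_of_preconnected_of_eventuallyEq_zero hUc hx₀ ?_
  exact SCV.eventually_eq_zero_of_eq_zero_on_reals_pi hρ (hf.mono hball) fun w hw =>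
    h0 w (hball (by rwa [mem_ball, dist_eq_norm]))

/-- **Real environments, Hilbert-space-valued form**: two holomorphic `H`-valued maps on an open
preconnected `U ⊆ ℂᵐ` containing a real point, which agree at the real points of `U`, agree on
`U` (the uniqueness of the vectors `Ψₙ(x, ζ)` of OS II (5.20)). [cite: OsterwalderSchraderCMP1975, Ch. V.2 (5.20)] -/
theorem eqOn_of_eqOn_reals_hilbert {Ψ₁ Ψ₂ : (Fin m → ℂ) → H} {U : Set (Fin m → ℂ)}
    (hU : IsOpen U) (hUc : IsPreconnected U) (h₁ : DifferentiableOn ℂ Ψ₁ U)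
    (h₂ : DifferentiableOn ℂ Ψ₂ U) {x₀ : Fin m → ℝ} (hx₀ : (fun i => (x₀ i : ℂ)) ∈ U)
    (h : ∀ w : Fin m → ℝ, (fun i => (w i : ℂ)) ∈ U →
      Ψ₁ (fun i => (w i : ℂ)) = Ψ₂ (fun i => (w i : ℂ))) :
    EqOn Ψ₁ Ψ₂ U := by
  intro z hz
  rw [← sub_eq_zero, ← inner_self_eq_zero (𝕜 := ℂ)]
  set v := Ψ₁ z - Ψ₂ z with hv
  have hf : DifferentiableOn ℂ (fun z' => ⟪v, Ψ₁ z' - Ψ₂ z'⟫_ℂ) U := by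
    have := (innerSL ℂ v).differentiable.comp_differentiableOn (h₁.sub h₂)
    simpa only [Function.comp_def, innerSL_apply_apply, Pi.sub_apply] using this
  have key := eqOn_zero_of_eq_zero_on_reals hU hUc hf hx₀ (fun w hw => by
    show ⟪v, Ψ₁ (fun i => (w i : ℂ)) - Ψ₂ (fun i => (w i : ℂ))⟫_ℂ = 0
    rw [h w hw, sub_self, inner_zero_right]) hz
  simpa [hv] using key

/-- Finite double sums `∑ᵢⱼ c̄ᵢ cⱼ ⟪uᵢ, uⱼ⟫` are the squared norms `⟪∑ cᵢuᵢ, ∑ cᵢuᵢ⟫`. [folklore] -/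
theorem sum_sum_conj_mul_inner {ι : Type*} (s : Finset ι) (c : ι → ℂ) (u : ι → H) :
    ∑ a ∈ s, ∑ b ∈ s, conj (c a) * c b * ⟪u a, u b⟫_ℂ =
      ⟪∑ a ∈ s, c a • u a, ∑ a ∈ s, c a • u a⟫_ℂ := by
  simp_rw [sum_inner, inner_sum, inner_smul_left, inner_smul_right]
  refine Finset.sum_congr rfl fun a _ => Finset.sum_congr rfl fun b _ => by ring

/-- `Re ⟪v, v⟫ = ‖v‖²` with the real part of `ℂ`. [folklore] -/
theorem inner_self_re_eq_norm_sq (v : H) : (⟪v, v⟫_ℂ).re = ‖v‖ ^ 2 := by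
  rw [← inner_self_eq_norm_sq (𝕜 := ℂ) v, RCLike.re_to_complex]

/-! ### The construction on one real-centred polydisc -/

section Local

variable {ξ r : Fin m → ℝ} {k : (Fin m → ℂ) → (Fin m → ℂ) → ℂ} {Φ : (Fin m → ℝ) → H}

/-- On the real points, `k(w̄, z)` is a Gram kernel, hence positive-semidefinite. [folklore] -/
theorem isPosSemidefKernelOn_gram_real
    (hGram : ∀ η η' : Fin m → ℝ, (fun i => (η i : ℂ)) ∈ polydisc (fun i => (ξ i : ℂ)) r →
      (fun i => (η' i : ℂ)) ∈ polydisc (fun i => (ξ i : ℂ)) r →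
      ⟪Φ η', Φ η⟫_ℂ = k (fun i => (η' i : ℂ)) (fun i => (η i : ℂ))) :
    IsPosSemidefKernelOn (fun w z => k (star w) z)
      {z | z ∈ polydisc (fun i => (ξ i : ℂ)) r ∧ ∀ i, (z i).im = 0} := by
  intro n x hx c
  set η : Fin n → Fin m → ℝ := fun a i => (x a i).re with hη
  have hxη : ∀ a, x a = fun i => (η a i : ℂ) := fun a => funext fun i => by
    apply Complex.ext
    · simp [hη]
    · simp [hη, (hx a).2 i]
  have hmem : ∀ a, (fun i => (η a i : ℂ)) ∈ polydisc (fun i => (ξ i : ℂ)) r := fun a =>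
    hxη a ▸ (hx a).1
  have hkab : ∀ a b, k (star (x a)) (x b) = ⟪Φ (η a), Φ (η b)⟫_ℂ := fun a b => by
    rw [hxη a, hxη b, star_ofReal_pt, hGram (η b) (η a) (hmem b) (hmem a)]
  simp_rw [hkab]
  rw [sum_sum_conj_mul_inner]
  set v := ∑ a, c a • Φ (η a)
  refine Complex.nonneg_iff.2 ⟨?_, ?_⟩
  · have h := inner_self_nonneg (𝕜 := ℂ) (x := v)
    rwa [RCLike.re_to_complex] at h
  · have h := inner_self_im (𝕜 := ℂ) v
    rw [RCLike.im_to_complex] at h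
    exact h.symm

/-- … hence positive-semidefinite on the whole polydisc, by Glaser's lemma on polydiscs. [cite: GlaserCMP1974, §2] -/
theorem isPosSemidefKernelOn_gram (hr : ∀ i, 0 < r i)
    (hk : DifferentiableOn ℂ (Function.uncurry k)
      (polydisc (fun i => (ξ i : ℂ)) r ×ˢ polydisc (fun i => (ξ i : ℂ)) r))
    (hGram : ∀ η η' : Fin m → ℝ, (fun i => (η i : ℂ)) ∈ polydisc (fun i => (ξ i : ℂ)) r →
      (fun i => (η' i : ℂ)) ∈ polydisc (fun i => (ξ i : ℂ)) r →
      ⟪Φ η', Φ η⟫_ℂ = k (fun i => (η' i : ℂ)) (fun i => (η i : ℂ))) :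
    IsPosSemidefKernelOn (fun w z => k (star w) z) (polydisc (fun i => (ξ i : ℂ)) r) :=
  isPosSemidefKernelOn_polydisc_of_real hr hk (fun _ _ _ _ => rfl) (isPosSemidefKernelOn_gram_real hGram)

/-- **The Cauchy–Schwarz bound for the functional `∑ cᵢ Φ(ηᵢ) ↦ ∑ cᵢ k(z̄, ηᵢ)`**:
`‖∑ cᵢ k(z̄, ηᵢ)‖² ≤ Re k(z̄, z) · ‖∑ cᵢ Φ(ηᵢ)‖²` for `z` in the polydisc and real points `ηᵢ`
of it. [folklore] -/
theorem norm_sum_mul_gram_sq_le (hr : ∀ i, 0 < r i)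
    (hk : DifferentiableOn ℂ (Function.uncurry k)
      (polydisc (fun i => (ξ i : ℂ)) r ×ˢ polydisc (fun i => (ξ i : ℂ)) r))
    (hGram : ∀ η η' : Fin m → ℝ, (fun i => (η i : ℂ)) ∈ polydisc (fun i => (ξ i : ℂ)) r →
      (fun i => (η' i : ℂ)) ∈ polydisc (fun i => (ξ i : ℂ)) r →
      ⟪Φ η', Φ η⟫_ℂ = k (fun i => (η' i : ℂ)) (fun i => (η i : ℂ)))
    {z : Fin m → ℂ} (hz : z ∈ polydisc (fun i => (ξ i : ℂ)) r) {ι : Type*} [Fintype ι]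
    (η : ι → Fin m → ℝ) (hη : ∀ a, (fun i => (η a i : ℂ)) ∈ polydisc (fun i => (ξ i : ℂ)) r)
    (c : ι → ℂ) :
    ‖∑ a, c a * k (star z) (fun i => (η a i : ℂ))‖ ^ 2 ≤
      (k (star z) z).re * ‖∑ a, c a • Φ (η a)‖ ^ 2 := by
  have hP := isPosSemidefKernelOn_gram hr hk hGram
  have h := hP.norm_sum_mul_sq_le hz (x := fun a => fun i => (η a i : ℂ)) hη c
  have hkab : ∀ a b, k (star (fun i => (η a i : ℂ))) (fun i => (η b i : ℂ)) = ⟪Φ (η a), Φ (η b)⟫_ℂ :=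
    fun a b => by rw [star_ofReal_pt, hGram _ _ (hη b) (hη a)]
  simp only [hkab] at h
  rwa [sum_sum_conj_mul_inner, inner_self_re_eq_norm_sq] at h

/-- **The vector at a complex point** (OS II (5.20), reproducing-kernel form): for `z` in the
polydisc there is `x` in the closed span of the real-point vectors with `⟪x, Φ η⟫ = k(z̄, η)` for
all real points `η` and `‖x‖ ≤ √Re k(z̄, z)` (first isomorphism theorem for the functional
`∑ cᵢ Φ(ηᵢ) ↦ ∑ cᵢ k(z̄, ηᵢ)`, Hahn–Banach, Riesz, orthogonal projection). [cite: OsterwalderSchraderCMP1975, Ch. V.2 (5.20)–(5.21)] -/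
theorem exists_gramVec [CompleteSpace H] (hr : ∀ i, 0 < r i)
    (hk : DifferentiableOn ℂ (Function.uncurry k)
      (polydisc (fun i => (ξ i : ℂ)) r ×ˢ polydisc (fun i => (ξ i : ℂ)) r))
    (hGram : ∀ η η' : Fin m → ℝ, (fun i => (η i : ℂ)) ∈ polydisc (fun i => (ξ i : ℂ)) r →
      (fun i => (η' i : ℂ)) ∈ polydisc (fun i => (ξ i : ℂ)) r →
      ⟪Φ η', Φ η⟫_ℂ = k (fun i => (η' i : ℂ)) (fun i => (η i : ℂ)))
    {z : Fin m → ℂ} (hz : z ∈ polydisc (fun i => (ξ i : ℂ)) r) :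
    ∃ x : H,
      x ∈ (Submodule.span ℂ (Set.range fun η : {η : Fin m → ℝ //
        (fun i => (η i : ℂ)) ∈ polydisc (fun i => (ξ i : ℂ)) r} => Φ η.1)).topologicalClosure ∧
      ‖x‖ ≤ Real.sqrt ((k (star z) z).re) ∧
      ∀ η : {η : Fin m → ℝ // (fun i => (η i : ℂ)) ∈ polydisc (fun i => (ξ i : ℂ)) r},
        ⟪x, Φ η.1⟫_ℂ = k (star z) (fun i => (η.1 i : ℂ)) := by
  classical
  set Λ : ({η : Fin m → ℝ // (fun i => (η i : ℂ)) ∈ polydisc (fun i => (ξ i : ℂ)) r} →₀ ℂ) →ₗ[ℂ] H :=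
    Finsupp.linearCombination ℂ (fun η : {η : Fin m → ℝ //
      (fun i => (η i : ℂ)) ∈ polydisc (fun i => (ξ i : ℂ)) r} => Φ η.1) with hΛ
  set L : ({η : Fin m → ℝ // (fun i => (η i : ℂ)) ∈ polydisc (fun i => (ξ i : ℂ)) r} →₀ ℂ) →ₗ[ℂ] ℂ :=
    Finsupp.linearCombination ℂ (fun η : {η : Fin m → ℝ //
      (fun i => (η i : ℂ)) ∈ polydisc (fun i => (ξ i : ℂ)) r} => k (star z) (fun i => (η.1 i : ℂ)))
    with hL
  set M : ℝ := Real.sqrt ((k (star z) z).re) with hM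
  have hM0 : 0 ≤ M := Real.sqrt_nonneg _
  have hre0 : 0 ≤ (k (star z) z).re := by
    have := (isPosSemidefKernelOn_gram hr hk hGram).apply_self_nonneg hz
    exact (Complex.nonneg_iff.1 this).1
  -- the Cauchy–Schwarz bound `‖L l‖ ≤ M ‖Λ l‖`
  have hbound : ∀ l, ‖L l‖ ≤ M * ‖Λ l‖ := by
    intro l
    have h := norm_sum_mul_gram_sq_le hr hk hGram hz (ι := l.support) (fun a => a.1.1)
      (fun a => a.1.2) (fun a => l a.1)
    have hLl : L l = ∑ a : l.support, l a.1 * k (star z) (fun i => (a.1.1 i : ℂ)) := by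
      rw [hL, Finsupp.linearCombination_apply, Finsupp.sum]
      simp only [smul_eq_mul]
      exact (Finset.sum_coe_sort l.support (fun η => l η * k (star z) (fun i => (η.1 i : ℂ)))).symm
    have hΛl : Λ l = ∑ a : l.support, l a.1 • Φ a.1.1 := by
      rw [hΛ, Finsupp.linearCombination_apply, Finsupp.sum]
      exact (Finset.sum_coe_sort l.support (fun η => l η • Φ η.1)).symm
    rw [hLl, hΛl]
    have h' : ‖∑ a : l.support, l a.1 * k (star z) (fun i => (a.1.1 i : ℂ))‖ ^ 2 ≤
        (M * ‖∑ a : l.support, l a.1 • Φ a.1.1‖) ^ 2 := by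
      rw [mul_pow, hM, Real.sq_sqrt hre0]; exact h
    exact le_of_pow_le_pow_left₀ two_ne_zero (by positivity) h'
  -- first isomorphism theorem: `L` descends to the range of `Λ`
  have hker : LinearMap.ker Λ ≤ LinearMap.ker L := fun l hl => by
    rw [LinearMap.mem_ker] at hl ⊢
    have := hbound l
    rw [hl, norm_zero, mul_zero] at this
    exact norm_le_zero_iff.1 this
  set L' : LinearMap.range Λ →ₗ[ℂ] ℂ :=
    ((LinearMap.ker Λ).liftQ L hker).comp Λ.quotKerEquivRange.symm.toLinearMap with hL'
  have hL'apply : ∀ l, L' ⟨Λ l, LinearMap.mem_range_self Λ l⟩ = L l := by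
    intro l
    have hq : Λ.quotKerEquivRange.symm ⟨Λ l, LinearMap.mem_range_self Λ l⟩ =
        Submodule.Quotient.mk l := by
      rw [LinearEquiv.symm_apply_eq]
      apply Subtype.ext
      rw [LinearMap.quotKerEquivRange_apply_mk]
    simp only [hL', LinearMap.comp_apply, LinearEquiv.coe_toLinearMap, hq, Submodule.liftQ_apply]
  have hL'bound : ∀ v : LinearMap.range Λ, ‖L' v‖ ≤ M * ‖v‖ := by
    rintro ⟨v, hv⟩
    obtain ⟨l, rfl⟩ := LinearMap.mem_range.1 hv
    rw [hL'apply l]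
    exact hbound l
  set L'c : LinearMap.range Λ →L[ℂ] ℂ := L'.mkContinuous M hL'bound with hL'c
  have hL'c_norm : ‖L'c‖ ≤ M := LinearMap.mkContinuous_norm_le _ hM0 _
  -- Hahn–Banach and Riesz
  obtain ⟨g, hg, hgnorm⟩ := exists_extension_norm_eq (LinearMap.range Λ) L'c
  set y : H := (InnerProductSpace.toDual ℂ H).symm g with hy
  have hy_inner : ∀ v, ⟪y, v⟫_ℂ = g v := fun v => InnerProductSpace.toDual_symm_apply
  have hy_norm : ‖y‖ ≤ M := by
    rw [hy, LinearIsometryEquiv.norm_map, hgnorm]; exact hL'c_norm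
  -- project onto the closed span
  set V : Submodule ℂ H := (LinearMap.range Λ).topologicalClosure with hV
  have hVeq : V = (Submodule.span ℂ (Set.range fun η : {η : Fin m → ℝ //
      (fun i => (η i : ℂ)) ∈ polydisc (fun i => (ξ i : ℂ)) r} => Φ η.1)).topologicalClosure := by
    rw [hV, hΛ, Finsupp.range_linearCombination]
  refine ⟨V.starProjection y, hVeq ▸ V.starProjection_apply_mem y,
    (V.norm_starProjection_apply_le y).trans hy_norm, fun η => ?_⟩
  have hΛ1 : Λ (Finsupp.single η 1) = Φ η.1 := by
    rw [hΛ, Finsupp.linearCombination_single, one_smul]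
  have hmemV : Φ η.1 ∈ V :=
    (LinearMap.range Λ).le_topologicalClosure ⟨Finsupp.single η 1, hΛ1⟩
  calc ⟪V.starProjection y, Φ η.1⟫_ℂ = ⟪y, V.starProjection (Φ η.1)⟫_ℂ :=
        V.inner_starProjection_left_eq_right y (Φ η.1)
    _ = ⟪y, Φ η.1⟫_ℂ := by rw [Submodule.starProjection_eq_self_iff.2 hmemV]
    _ = g (Φ η.1) := hy_inner _
    _ = g (Λ (Finsupp.single η 1)) := by rw [hΛ1]
    _ = L'c ⟨Λ (Finsupp.single η 1), LinearMap.mem_range_self Λ _⟩ :=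
        hg ⟨Λ (Finsupp.single η 1), LinearMap.mem_range_self Λ _⟩
    _ = L (Finsupp.single η 1) := by
        rw [hL'c, LinearMap.mkContinuous_apply, hL'apply]
    _ = k (star z) (fun i => (η.1 i : ℂ)) := by
        rw [hL, Finsupp.linearCombination_single, one_smul]

/-- **Holomorphic vectors on one real-centred polydisc** (OS II, (P_N) on the polydisc `P` of
(5.19)–(5.21)): with `P = D(ξ, r)`, `k` jointly holomorphic on `P × P` and
`⟪Φ η', Φ η⟫ = k(η', η)` at real points of `P`, there is `Ψ` holomorphic on `P`, equal to `Φ` at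
the real points, with values in the closed span of the `Φ(η)`, `‖Ψ z‖ ≤ √Re k(z̄, z)`, and
`⟪Ψ w, Ψ z⟫ = k(w̄, z)` on `P × P`. [cite: OsterwalderSchraderCMP1975, Ch. V.2 (5.17)–(5.21)] -/
theorem exists_holomorphic_gramVec_polydisc [CompleteSpace H] (hr : ∀ i, 0 < r i)
    (hk : DifferentiableOn ℂ (Function.uncurry k)
      (polydisc (fun i => (ξ i : ℂ)) r ×ˢ polydisc (fun i => (ξ i : ℂ)) r))
    (hGram : ∀ η η' : Fin m → ℝ, (fun i => (η i : ℂ)) ∈ polydisc (fun i => (ξ i : ℂ)) r →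
      (fun i => (η' i : ℂ)) ∈ polydisc (fun i => (ξ i : ℂ)) r →
      ⟪Φ η', Φ η⟫_ℂ = k (fun i => (η' i : ℂ)) (fun i => (η i : ℂ))) :
    ∃ Ψ : (Fin m → ℂ) → H,
      DifferentiableOn ℂ Ψ (polydisc (fun i => (ξ i : ℂ)) r) ∧
      (∀ η : Fin m → ℝ, (fun i => (η i : ℂ)) ∈ polydisc (fun i => (ξ i : ℂ)) r →
        Ψ (fun i => (η i : ℂ)) = Φ η) ∧
      (∀ z ∈ polydisc (fun i => (ξ i : ℂ)) r, Ψ z ∈ (Submodule.span ℂ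
        (Φ '' {η | (fun i => (η i : ℂ)) ∈ polydisc (fun i => (ξ i : ℂ)) r})).topologicalClosure) ∧
      (∀ z ∈ polydisc (fun i => (ξ i : ℂ)) r, ‖Ψ z‖ ≤ Real.sqrt ((k (star z) z).re)) ∧
      ∀ w ∈ polydisc (fun i => (ξ i : ℂ)) r, ∀ z ∈ polydisc (fun i => (ξ i : ℂ)) r,
        ⟪Ψ w, Ψ z⟫_ℂ = k (star w) z := by
  classical
  choose! Ψ hmem hnorm hinner using
    fun z (hz : z ∈ polydisc (fun i => (ξ i : ℂ)) r) => exists_gramVec hr hk hGram hz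
  set Sg : Set H := Set.range fun η : {η : Fin m → ℝ //
      (fun i => (η i : ℂ)) ∈ polydisc (fun i => (ξ i : ℂ)) r} => Φ η.1 with hSg
  set V : Submodule ℂ H := (Submodule.span ℂ Sg).topologicalClosure with hV
  have hPo : IsOpen (polydisc (fun i => (ξ i : ℂ)) r) := isOpen_polydisc _ _
  have hPD := isPosSemidefKernelOn_gram hr hk hGram
  -- (a) the matrix elements against the generators, in holomorphic form
  have hinner' : ∀ z ∈ polydisc (fun i => (ξ i : ℂ)) r, ∀ η : {η : Fin m → ℝ //
      (fun i => (η i : ℂ)) ∈ polydisc (fun i => (ξ i : ℂ)) r},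
      ⟪Φ η.1, Ψ z⟫_ℂ = k (fun i => (η.1 i : ℂ)) z := by
    intro z hz η
    rw [← inner_conj_symm, hinner z hz η]
    have h := hPD.conj_symm hz η.2
    simpa only [star_ofReal_pt] using h
  -- (b) local boundedness
  have hb : ∀ z₀ ∈ polydisc (fun i => (ξ i : ℂ)) r, ∃ ρ > 0, ∃ C : ℝ, ∀ z ∈ ball z₀ ρ, ‖Ψ z‖ ≤ C := by
    intro z₀ hz₀
    have hcont : ContinuousAt (fun z : Fin m → ℂ => (k (star z) z).re) z₀ := by
      have h1 : ContinuousAt (fun z : Fin m → ℂ => (star z, z)) z₀ :=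
        (continuous_star.prodMk continuous_id).continuousAt
      have h2 : ContinuousAt (Function.uncurry k) (star z₀, z₀) :=
        hk.continuousOn.continuousAt ((hPo.prod hPo).mem_nhds ⟨star_mem_polydisc_ofReal hz₀, hz₀⟩)
      exact Complex.continuous_re.continuousAt.comp (h2.comp_of_eq h1 rfl)
    obtain ⟨ρ₁, hρ₁, hball⟩ := Metric.isOpen_iff.1 hPo z₀ hz₀
    obtain ⟨ρ₂, hρ₂, hρ₂'⟩ := Metric.eventually_nhds_iff.1 ((Metric.tendsto_nhds.1 hcont) 1 one_pos)
    refine ⟨min ρ₁ ρ₂, lt_min hρ₁ hρ₂, Real.sqrt ((k (star z₀) z₀).re + 1), fun z hz => ?_⟩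
    have hzP : z ∈ polydisc (fun i => (ξ i : ℂ)) r := hball (ball_subset_ball (min_le_left _ _) hz)
    have hd := hρ₂' (ball_subset_ball (min_le_right _ _) hz)
    rw [Real.dist_eq] at hd
    refine (hnorm z hzP).trans (Real.sqrt_le_sqrt ?_)
    linarith [(abs_lt.1 hd).2]
  -- (c) holomorphy, by weak holomorphy against the closed span and its orthogonal complement
  have hhol : DifferentiableOn ℂ Ψ (polydisc (fun i => (ξ i : ℂ)) r) := by
    refine differentiableOn_of_weakly_holomorphic_pi hPo (fun φ => ?_) hb
    set v : H := (InnerProductSpace.toDual ℂ H).symm φ with hvdef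
    have hφ : ∀ x, φ x = ⟪v, x⟫_ℂ := fun x => by
      rw [hvdef, InnerProductSpace.toDual_symm_apply]
    simp only [hφ]
    have hgen : ∀ u ∈ Sg, DifferentiableOn ℂ (fun z => ⟪u, Ψ z⟫_ℂ) (polydisc (fun i => (ξ i : ℂ)) r) := by
      rintro _ ⟨η, rfl⟩
      have hslice : DifferentiableOn ℂ (fun z => k (fun i => (η.1 i : ℂ)) z)
          (polydisc (fun i => (ξ i : ℂ)) r) :=
        hk.comp ((differentiableOn_const _).prodMk differentiableOn_id) fun z hz => ⟨η.2, hz⟩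
      exact hslice.congr fun z hz => hinner' z hz η
    have hV' : DifferentiableOn ℂ (fun z => ⟪V.starProjection v, Ψ z⟫_ℂ)
        (polydisc (fun i => (ξ i : ℂ)) r) :=
      differentiableOn_inner_of_mem_topologicalClosure_span_pi hPo hb hgen (V.starProjection_apply_mem v)
    refine hV'.congr fun z hz => ?_
    have horth : ⟪v - V.starProjection v, Ψ z⟫_ℂ = 0 :=
      Submodule.inner_left_of_mem_orthogonal (hmem z hz) (V.sub_starProjection_mem_orthogonal v)
    rw [inner_sub_left, sub_eq_zero] at horth
    exact horth
  -- (d) the real points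
  have hreal : ∀ η : Fin m → ℝ, (fun i => (η i : ℂ)) ∈ polydisc (fun i => (ξ i : ℂ)) r →
      Ψ (fun i => (η i : ℂ)) = Φ η := by
    intro η₀ hη₀
    have hΦmem : Φ η₀ ∈ Submodule.span ℂ Sg := Submodule.subset_span ⟨⟨η₀, hη₀⟩, rfl⟩
    have hu : Ψ (fun i => (η₀ i : ℂ)) - Φ η₀ ∈ V :=
      sub_mem (hmem _ hη₀) ((Submodule.span ℂ Sg).le_topologicalClosure hΦmem)
    have horth : Ψ (fun i => (η₀ i : ℂ)) - Φ η₀ ∈ (Submodule.span ℂ Sg)ᗮ := by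
      rw [Submodule.mem_orthogonal]
      intro u hu'
      induction hu' using Submodule.span_induction with
      | mem u hu' =>
        obtain ⟨η, rfl⟩ := hu'
        rw [inner_sub_right, hinner' _ hη₀ η, hGram η₀ η.1 hη₀ η.2, sub_self]
      | zero => exact inner_zero_left _
      | add u u' _ _ hu hu' => rw [inner_add_left, hu, hu', add_zero]
      | smul a u _ hu => rw [inner_smul_left, hu, mul_zero]
    have hboth : Ψ (fun i => (η₀ i : ℂ)) - Φ η₀ ∈ (Submodule.span ℂ Sg)ᗮ ⊓ (Submodule.span ℂ Sg)ᗮᗮ :=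
      ⟨horth, by rw [Submodule.orthogonal_orthogonal_eq_closure]; exact hu⟩
    rw [Submodule.inf_orthogonal_eq_bot, Submodule.mem_bot, sub_eq_zero] at hboth
    exact hboth
  -- (e) the Gram identity, from its real-point case by the identity theorem
  have hgram : ∀ w ∈ polydisc (fun i => (ξ i : ℂ)) r, ∀ z ∈ polydisc (fun i => (ξ i : ℂ)) r,
      ⟪Ψ w, Ψ z⟫_ℂ = k (star w) z := by
    intro w hw
    have hf : DifferentiableOn ℂ (fun z => ⟪Ψ w, Ψ z⟫_ℂ - k (star w) z)
        (polydisc (fun i => (ξ i : ℂ)) r) := by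
      refine DifferentiableOn.sub ?_ ?_
      · have := (innerSL ℂ (Ψ w)).differentiable.comp_differentiableOn hhol
        simpa only [Function.comp_def, innerSL_apply_apply, Pi.sub_apply] using this
      · exact hk.comp ((differentiableOn_const _).prodMk differentiableOn_id)
          fun z hz => ⟨star_mem_polydisc_ofReal hw, hz⟩
    have h0 : ∀ η : Fin m → ℝ, (fun i => (η i : ℂ)) ∈ polydisc (fun i => (ξ i : ℂ)) r →
        ⟪Ψ w, Ψ (fun i => (η i : ℂ))⟫_ℂ - k (star w) (fun i => (η i : ℂ)) = 0 := by
      intro η hη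
      rw [hreal η hη, hinner w hw ⟨η, hη⟩, sub_self]
    intro z hz
    have := eqOn_zero_of_eq_zero_on_reals hPo (convex_polydisc _ _).isPreconnected hf
      (ofReal_mem_polydisc hr) h0 hz
    exact sub_eq_zero.1 this
  refine ⟨Ψ, hhol, hreal, fun z hz => ?_, hnorm, hgram⟩
  have hSg' : Sg = Φ '' {η | (fun i => (η i : ℂ)) ∈ polydisc (fun i => (ξ i : ℂ)) r} := by
    ext u
    simp only [hSg, Set.mem_range, Set.mem_image, Set.mem_setOf_eq, Subtype.exists, exists_prop]
  rw [← hSg']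
  exact hmem z hz

end Local

/-! ### Gluing: the theorem on a union of real-centred polydiscs -/

section Global

variable [CompleteSpace H]

/-- **Holomorphic vectors from a sesqui-holomorphic Gram kernel** (the step (A_N) ⇒ (P_N) of
Osterwalder–Schrader II, Ch. V.2, (5.16)–(5.21), abstract form; module docstring). Let every point
of `Ω ⊆ ℂᵐ` lie in a real-centred open polydisc `P ⊆ Ω` on whose square `k` is jointly
holomorphic, and let `⟪Φ η', Φ η⟫ = k(η', η)` at the real points of `Ω`. Then there is
`Ψ : ℂᵐ → H` holomorphic on `Ω`, equal to `Φ` at the real points of `Ω`, with values in the closed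
span of `Φ(Ω ∩ ℝᵐ)`, and with `⟪Ψ w, Ψ z⟫ = k(w̄, z)` for `w, z` in every such polydisc. [cite: OsterwalderSchraderCMP1975, Ch. V.2 (5.16)–(5.21)] -/
theorem exists_holomorphic_gramVec {Ω : Set (Fin m → ℂ)} {k : (Fin m → ℂ) → (Fin m → ℂ) → ℂ}
    {Φ : (Fin m → ℝ) → H}
    (hΩ : ∀ z ∈ Ω, ∃ ξ r : Fin m → ℝ, z ∈ polydisc (fun i => (ξ i : ℂ)) r ∧ (∀ i, 0 < r i) ∧
      polydisc (fun i => (ξ i : ℂ)) r ⊆ Ω ∧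
      DifferentiableOn ℂ (Function.uncurry k)
        (polydisc (fun i => (ξ i : ℂ)) r ×ˢ polydisc (fun i => (ξ i : ℂ)) r))
    (hGram : ∀ η η' : Fin m → ℝ, (fun i => (η i : ℂ)) ∈ Ω → (fun i => (η' i : ℂ)) ∈ Ω →
      ⟪Φ η', Φ η⟫_ℂ = k (fun i => (η' i : ℂ)) (fun i => (η i : ℂ))) :
    ∃ Ψ : (Fin m → ℂ) → H,
      DifferentiableOn ℂ Ψ Ω ∧
      (∀ η : Fin m → ℝ, (fun i => (η i : ℂ)) ∈ Ω → Ψ (fun i => (η i : ℂ)) = Φ η) ∧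
      (∀ z ∈ Ω, Ψ z ∈ (Submodule.span ℂ (Φ '' {η | (fun i => (η i : ℂ)) ∈ Ω})).topologicalClosure) ∧
      ∀ ξ r : Fin m → ℝ, (∀ i, 0 < r i) → polydisc (fun i => (ξ i : ℂ)) r ⊆ Ω →
        DifferentiableOn ℂ (Function.uncurry k)
          (polydisc (fun i => (ξ i : ℂ)) r ×ˢ polydisc (fun i => (ξ i : ℂ)) r) →
        ∀ w ∈ polydisc (fun i => (ξ i : ℂ)) r, ∀ z ∈ polydisc (fun i => (ξ i : ℂ)) r,
          ⟪Ψ w, Ψ z⟫_ℂ = k (star w) z := by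
  classical
  -- the local theorem on every admissible chart
  have hloc : ∀ ξ r : Fin m → ℝ, (∀ i, 0 < r i) → polydisc (fun i => (ξ i : ℂ)) r ⊆ Ω →
      DifferentiableOn ℂ (Function.uncurry k)
        (polydisc (fun i => (ξ i : ℂ)) r ×ˢ polydisc (fun i => (ξ i : ℂ)) r) →
      ∃ Ψ : (Fin m → ℂ) → H,
        DifferentiableOn ℂ Ψ (polydisc (fun i => (ξ i : ℂ)) r) ∧
        (∀ η : Fin m → ℝ, (fun i => (η i : ℂ)) ∈ polydisc (fun i => (ξ i : ℂ)) r →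
          Ψ (fun i => (η i : ℂ)) = Φ η) ∧
        (∀ z ∈ polydisc (fun i => (ξ i : ℂ)) r, Ψ z ∈ (Submodule.span ℂ
          (Φ '' {η | (fun i => (η i : ℂ)) ∈ polydisc (fun i => (ξ i : ℂ)) r})).topologicalClosure) ∧
        ∀ w ∈ polydisc (fun i => (ξ i : ℂ)) r, ∀ z ∈ polydisc (fun i => (ξ i : ℂ)) r,
          ⟪Ψ w, Ψ z⟫_ℂ = k (star w) z := by
    intro ξ r hr hsub hk
    obtain ⟨Ψ, h1, h2, h3, -, h5⟩ := exists_holomorphic_gramVec_polydisc hr hk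
      (fun η η' hη hη' => hGram η η' (hsub hη) (hsub hη'))
    exact ⟨Ψ, h1, h2, h3, h5⟩
  -- uniqueness on overlaps
  have huniq : ∀ (ξ₁ r₁ ξ₂ r₂ : Fin m → ℝ) (Ψ₁ Ψ₂ : (Fin m → ℂ) → H),
      DifferentiableOn ℂ Ψ₁ (polydisc (fun i => (ξ₁ i : ℂ)) r₁) →
      (∀ η : Fin m → ℝ, (fun i => (η i : ℂ)) ∈ polydisc (fun i => (ξ₁ i : ℂ)) r₁ →
          Ψ₁ (fun i => (η i : ℂ)) = Φ η) →
      DifferentiableOn ℂ Ψ₂ (polydisc (fun i => (ξ₂ i : ℂ)) r₂) →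
      (∀ η : Fin m → ℝ, (fun i => (η i : ℂ)) ∈ polydisc (fun i => (ξ₂ i : ℂ)) r₂ →
          Ψ₂ (fun i => (η i : ℂ)) = Φ η) →
      EqOn Ψ₁ Ψ₂ (polydisc (fun i => (ξ₁ i : ℂ)) r₁ ∩ polydisc (fun i => (ξ₂ i : ℂ)) r₂) := by
    intro ξ₁ r₁ ξ₂ r₂ Ψ₁ Ψ₂ h₁ h₁r h₂ h₂r u hu
    have hx₀ : (fun i => (((u i).re : ℝ) : ℂ)) ∈
        polydisc (fun i => (ξ₁ i : ℂ)) r₁ ∩ polydisc (fun i => (ξ₂ i : ℂ)) r₂ :=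
      ⟨re_mem_polydisc_ofReal hu.1, re_mem_polydisc_ofReal hu.2⟩
    exact eqOn_of_eqOn_reals_hilbert ((isOpen_polydisc _ _).inter (isOpen_polydisc _ _))
      ((convex_polydisc _ _).inter (convex_polydisc _ _)).isPreconnected
      (h₁.mono inter_subset_left) (h₂.mono inter_subset_right) hx₀
      (fun w hw => by rw [h₁r w hw.1, h₂r w hw.2]) hu
  -- choose charts and local maps
  choose! ξc rc hzc hrc hsubc hkc using hΩ
  choose! Ψl hΨhol hΨreal hΨmem hΨgram using hloc
  refine ⟨fun z => Ψl (ξc z) (rc z) z, ?_, ?_, ?_, ?_⟩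
  · -- holomorphy: near `z₀` the glued map is the local map of the chart at `z₀`
    intro z₀ hz₀
    have hP₀ : polydisc (fun i => (ξc z₀ i : ℂ)) (rc z₀) ∈ 𝓝 z₀ :=
      (isOpen_polydisc _ _).mem_nhds (hzc z₀ hz₀)
    have hev : (fun z => Ψl (ξc z) (rc z) z) =ᶠ[𝓝 z₀] Ψl (ξc z₀) (rc z₀) := by
      filter_upwards [hP₀] with z hz
      have hzΩ : z ∈ Ω := hsubc z₀ hz₀ hz
      exact huniq _ _ _ _ _ _ (hΨhol _ _ (hrc z hzΩ) (hsubc z hzΩ) (hkc z hzΩ))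
        (hΨreal _ _ (hrc z hzΩ) (hsubc z hzΩ) (hkc z hzΩ))
        (hΨhol _ _ (hrc z₀ hz₀) (hsubc z₀ hz₀) (hkc z₀ hz₀))
        (hΨreal _ _ (hrc z₀ hz₀) (hsubc z₀ hz₀) (hkc z₀ hz₀)) ⟨hzc z hzΩ, hz⟩
    have hd : DifferentiableAt ℂ (Ψl (ξc z₀) (rc z₀)) z₀ :=
      (hΨhol _ _ (hrc z₀ hz₀) (hsubc z₀ hz₀) (hkc z₀ hz₀)).differentiableAt hP₀
    exact (hd.congr_of_eventuallyEq hev).differentiableWithinAt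
  · intro η hη
    exact hΨreal _ _ (hrc _ hη) (hsubc _ hη) (hkc _ hη) η (hzc _ hη)
  · intro z hz
    refine Submodule.topologicalClosure_mono (Submodule.span_mono (Set.image_mono ?_))
      (hΨmem _ _ (hrc z hz) (hsubc z hz) (hkc z hz) z (hzc z hz))
    exact fun η hη => hsubc z hz hη
  · intro ξ r hr hsub hk w hw z hz
    have hagree : EqOn (fun z => Ψl (ξc z) (rc z) z) (Ψl ξ r) (polydisc (fun i => (ξ i : ℂ)) r) := by
      intro u hu
      have huΩ : u ∈ Ω := hsub hu
      exact huniq _ _ _ _ _ _ (hΨhol _ _ (hrc u huΩ) (hsubc u huΩ) (hkc u huΩ))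
        (hΨreal _ _ (hrc u huΩ) (hsubc u huΩ) (hkc u huΩ))
        (hΨhol _ _ hr hsub hk) (hΨreal _ _ hr hsub hk) ⟨hzc u huΩ, hu⟩
    have h1 : Ψl (ξc w) (rc w) w = Ψl ξ r w := hagree hw
    have h2 : Ψl (ξc z) (rc z) z = Ψl ξ r z := hagree hz
    show ⟪Ψl (ξc w) (rc w) w, Ψl (ξc z) (rc z) z⟫_ℂ = k (star w) z
    rw [h1, h2]
    exact hΨgram _ _ hr hsub hk w hw z hz

omit [CompleteSpace H] in
/-- **Norms of the vectors**: `‖Ψ z‖² = Re k(z̄, z)` wherever the Gram identity holds at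
`(z, z)` (OS II (5.21): the norm of `Ψₙ(x, ζ)` is `S_{2n-1}(ζ̄, 2x, ζ)`). [cite: OsterwalderSchraderCMP1975, Ch. V.2 (5.21)] -/
theorem norm_sq_eq_re_of_gram {Ψ : (Fin m → ℂ) → H} {k : (Fin m → ℂ) → (Fin m → ℂ) → ℂ}
    {z : Fin m → ℂ} (h : ⟪Ψ z, Ψ z⟫_ℂ = k (star z) z) : ‖Ψ z‖ ^ 2 = (k (star z) z).re := by
  rw [← h, inner_self_re_eq_norm_sq]

end Global

end Literature.MathematicalPhysics.QuantumFieldTheory
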